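import Summits.AnomalousDissipation.AnomalousDissipation.Theorems.ScalarAnomalySteadySourceFormal.Negative.ForcedModes
import Literature.Analysis.FunctionSpaces.TorusFourierModes
import Literature.Analysis.FunctionSpaces.TorusSobolevNormFacts

/-!
# Negative knowledge for the crux `ScalarAnomalySteadySourceFormal` (stmt-AnomalousDissipation-0448), VII-a:
# modal transport symbol of a trigonometric-polynomial (band-limited) stirring field

Certified copy of §9.1 of the cdisprove work file.  For a velocity field that is, at each time, a
real trigonometric polynomial `u(t) = realTrigPoly S (c t)` (the swept Marchioro states of
`Literature.Barriers.AnomalousDissipation.GravestModeLaminarAttractorSwept`, Kolmogorov / Galerkin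
shear flows, constant drifts), the flux modes of ANY weak solution of the crux's forced class expand
in finitely many neighbouring scalar modes:

* `mFourierCoeff_mFourier_mul` — the shift rule `𝓕(e_q f)(p) = 𝓕f(p - q)`;
* `coe_realTrigPoly_apply` — `u_j(x) = ½ ∑_{k∈S} (e_k(x) c_{k,j} + e_{-k}(x) conj c_{k,j})`;
* `mFourierCoeff_mul_realTrigPoly_apply` — `𝓕(θ u_j)(p) = ½ ∑_{k∈S} (c_{k,j} 𝓕θ(p-k) + conj c_{k,j} 𝓕θ(p+k))`;
* `transportMode` and `sum_mFourierCoeff_flux_eq_transportMode` —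
  `∑ⱼ 2πi pⱼ 𝓕(θuⱼ)(p) = πi ∑_{k∈S} ((p·c_k) 𝓕θ(p-k) + (p·conj c_k) 𝓕θ(p+k))`;
* `trig_ae_mode_eq` — the modewise integral equation of `Negative.ForcedModes` specialised to such
  stirring: `𝓕θ(t)(p) = 𝓕θ₀(p) + ∫_{(0,t]} (-4π²ν|p|² 𝓕θ(s)(p) - N_p(s) + 𝓕h(p)) ds` for a.e. `t`,
  with the integrand integrable on `(0,T)` (`trig_integrableOn_modeRHS`).

Supports stmt-AnomalousDissipation-0448 (the shear–drift no-go, files `Shear*`).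
-/

set_option linter.dupNamespace false

noncomputable section

open scoped BigOperators Topology ENNReal NNReal InnerProductSpace ContDiff
open Filter Set Function MeasureTheory UnitAddTorus Complex

namespace Summit.AnomalousDissipation.AnomalousDissipation.Theorems.ScalarAnomalySteadySourceFormal.Negative

open Literature.Analysis
open Literature.Analysis.FunctionSpaces Literature.Analysis.FunctionSpaces.Torus
open Literature.Analysis.FluidPDE Literature.Analysis.FluidPDE.Torus

variable {d : Type*} [Fintype d]

section TrigModes

/-- **Shift rule**: `𝓕(e_q f)(p) = 𝓕f(p - q)` (no integrability needed). [folklore] -/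
theorem mFourierCoeff_mFourier_mul (f : UnitAddTorus d → ℂ) (q p : d → ℤ) :
    mFourierCoeff (fun x => mFourier q x * f x) p = mFourierCoeff f (p - q) := by
  simp only [FunctionSpaces.Torus.mFourierCoeff_eq_integral_volume, smul_eq_mul]
  congr 1
  funext x
  rw [← mul_assoc, ← mFourier_add]
  congr 2
  abel

/-- The components of a real trigonometric polynomial as complex character sums:
`u_j(x) = ½ ∑_{k∈S} (e_k(x) c_{k,j} + e_{-k}(x) conj c_{k,j})`. [folklore] -/
theorem coe_realTrigPoly_apply (S : Finset (d → ℤ)) (cc : (d → ℤ) → EuclideanSpace ℂ d)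
    (x : UnitAddTorus d) (j : d) :
    (realTrigPoly S cc x j : ℂ) =
      2⁻¹ * ∑ k ∈ S, (mFourier k x * cc k j + mFourier (-k) x * (starRingEnd ℂ) (cc k j)) := by
  rw [realTrigPoly_apply_eq_sum, WithLp.ofLp_sum, Finset.sum_apply]
  push_cast
  rw [Finset.mul_sum]
  refine Finset.sum_congr rfl fun k _ => ?_
  rw [EuclideanSpace.realPart_apply, PiLp.smul_apply, smul_eq_mul, Complex.re_eq_add_conj, map_mul,
    ← mFourier_neg]
  ring

/-- Integrability of `e_q · θ` for integrable real `θ`. [folklore] -/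
theorem integrable_mFourier_mul_ofReal {θs : UnitAddTorus d → ℝ} (hθs : Integrable θs volume) (q : d → ℤ) :
    Integrable (fun x => mFourier q x * (θs x : ℂ)) volume :=
  (ofRealCLM.integrable_comp hθs).bdd_mul (c := 1) (mFourier q).continuous.aestronglyMeasurable
    (Eventually.of_forall fun x => ((mFourier q).norm_coe_le_norm x).trans_eq mFourier_norm)

/-- **Flux modes of a trigonometric-polynomial stirring field**:
`𝓕(θ u_j)(p) = ½ ∑_{k∈S} (c_{k,j} 𝓕θ(p-k) + conj c_{k,j} 𝓕θ(p+k))` for integrable `θ`. [folklore] -/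
theorem mFourierCoeff_mul_realTrigPoly_apply {θs : UnitAddTorus d → ℝ} (hθs : Integrable θs volume)
    (S : Finset (d → ℤ)) (cc : (d → ℤ) → EuclideanSpace ℂ d) (j : d) (p : d → ℤ) :
    mFourierCoeff (fun x => ((θs x * realTrigPoly S cc x j : ℝ) : ℂ)) p =
      2⁻¹ * ∑ k ∈ S, (cc k j * mFourierCoeff (fun x => (θs x : ℂ)) (p - k) +
        (starRingEnd ℂ) (cc k j) * mFourierCoeff (fun x => (θs x : ℂ)) (p + k)) := by
  have hpt : (fun x => ((θs x * realTrigPoly S cc x j : ℝ) : ℂ)) =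
      (2⁻¹ : ℂ) • fun x => ∑ k ∈ S, (cc k j * (mFourier k x * (θs x : ℂ)) +
        (starRingEnd ℂ) (cc k j) * (mFourier (-k) x * (θs x : ℂ))) := by
    funext x
    simp only [Pi.smul_apply, smul_eq_mul]
    push_cast
    rw [coe_realTrigPoly_apply, ← mul_assoc, mul_comm (θs x : ℂ), mul_assoc, Finset.mul_sum]
    congr 1
    refine Finset.sum_congr rfl fun k _ => ?_
    ring
  rw [hpt, mFourierCoeff_const_smul, smul_eq_mul]
  congr 1
  have hint : ∀ k ∈ S, Integrable (fun x => cc k j * (mFourier k x * (θs x : ℂ)) +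
      (starRingEnd ℂ) (cc k j) * (mFourier (-k) x * (θs x : ℂ))) volume := fun k _ =>
    ((integrable_mFourier_mul_ofReal hθs k).const_mul _).add ((integrable_mFourier_mul_ofReal hθs (-k)).const_mul _)
  rw [mFourierCoeff_finset_sum S hint]
  refine Finset.sum_congr rfl fun k _ => ?_
  have hadd := FunctionSpaces.Torus.mFourierCoeff_add ((integrable_mFourier_mul_ofReal hθs k).const_mul (cc k j))
    ((integrable_mFourier_mul_ofReal hθs (-k)).const_mul ((starRingEnd ℂ) (cc k j))) p
  simp only [Pi.add_def] at hadd
  rw [hadd]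
  have e1 : (fun x => cc k j * (mFourier k x * (θs x : ℂ))) = (cc k j) • fun x => mFourier k x * (θs x : ℂ) := by
    funext x; simp
  have e2 : (fun x => (starRingEnd ℂ) (cc k j) * (mFourier (-k) x * (θs x : ℂ))) =
      ((starRingEnd ℂ) (cc k j)) • fun x => mFourier (-k) x * (θs x : ℂ) := by
    funext x; simp
  rw [e1, e2, mFourierCoeff_const_smul, mFourierCoeff_const_smul, smul_eq_mul, smul_eq_mul,
    mFourierCoeff_mFourier_mul, mFourierCoeff_mFourier_mul, sub_neg_eq_add]

/-- **The transport symbol** of the stirring field `realTrigPoly S cc` acting on scalar modes `Y`: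
`N_p = πi ∑_{k∈S} ((p·c_k) Y(p-k) + (p·conj c_k) Y(p+k))`. [folklore] -/
def transportMode (S : Finset (d → ℤ)) (cc : (d → ℤ) → EuclideanSpace ℂ d) (Y : (d → ℤ) → ℂ) (p : d → ℤ) : ℂ :=
  Real.pi * I * ∑ k ∈ S, ((∑ j, (p j : ℂ) * cc k j) * Y (p - k) +
    (∑ j, (p j : ℂ) * (starRingEnd ℂ) (cc k j)) * Y (p + k))

/-- **Flux divergence in modes**: `∑ⱼ 2πi pⱼ 𝓕(θ uⱼ)(p) = N_p(𝓕θ)` for `u = realTrigPoly S cc` and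
integrable `θ`. [folklore] -/
theorem sum_mFourierCoeff_flux_eq_transportMode {θs : UnitAddTorus d → ℝ} (hθs : Integrable θs volume)
    (S : Finset (d → ℤ)) (cc : (d → ℤ) → EuclideanSpace ℂ d) (p : d → ℤ) :
    ∑ j, (2 * Real.pi * I * (p j)) * mFourierCoeff (fun x => ((θs x * realTrigPoly S cc x j : ℝ) : ℂ)) p =
      transportMode S cc (fun q => mFourierCoeff (fun x => (θs x : ℂ)) q) p := by
  simp_rw [mFourierCoeff_mul_realTrigPoly_apply hθs S cc]
  set Y : (d → ℤ) → ℂ := fun q => mFourierCoeff (fun x => (θs x : ℂ)) q with hY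
  set φ : d → (d → ℤ) → ℂ := fun j k =>
    Real.pi * I * ((p j : ℂ) * cc k j * Y (p - k) + (p j : ℂ) * (starRingEnd ℂ) (cc k j) * Y (p + k)) with hφ
  have hL : ∀ j, (2 * Real.pi * I * (p j)) * (2⁻¹ * ∑ k ∈ S, (cc k j * Y (p - k) +
      (starRingEnd ℂ) (cc k j) * Y (p + k))) = ∑ k ∈ S, φ j k := by
    intro j
    rw [← mul_assoc, Finset.mul_sum]
    refine Finset.sum_congr rfl fun k _ => ?_
    simp only [hφ]
    ring
  have hR : transportMode S cc Y p = ∑ k ∈ S, ∑ j, φ j k := by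
    rw [transportMode, Finset.mul_sum]
    refine Finset.sum_congr rfl fun k _ => ?_
    rw [Finset.sum_mul, Finset.sum_mul, mul_add, Finset.mul_sum, Finset.mul_sum, ← Finset.sum_add_distrib]
    refine Finset.sum_congr rfl fun j _ => ?_
    simp only [hφ]
    ring
  rw [hR, Finset.sum_comm]
  exact Finset.sum_congr rfl fun j _ => hL j

/-- Crude bound on the transport symbol: `‖N_p(Y)‖ ≤ π ∑_{k∈S} (∑ⱼ |pⱼ|) ‖c_k‖ (‖Y(p-k)‖ + ‖Y(p+k)‖)`. [folklore] -/
theorem norm_transportMode_le (S : Finset (d → ℤ)) (cc : (d → ℤ) → EuclideanSpace ℂ d) (Y : (d → ℤ) → ℂ)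
    (p : d → ℤ) :
    ‖transportMode S cc Y p‖ ≤ Real.pi * ∑ k ∈ S, (∑ j, |(p j : ℝ)|) * ‖cc k‖ * (‖Y (p - k)‖ + ‖Y (p + k)‖) := by
  rw [transportMode, norm_mul, norm_mul, Complex.norm_real, Complex.norm_I, mul_one, Real.norm_eq_abs,
    abs_of_pos Real.pi_pos]
  refine mul_le_mul_of_nonneg_left ((norm_sum_le _ _).trans (Finset.sum_le_sum fun k _ => ?_)) Real.pi_pos.le
  have hdot : ∀ (w : d → ℂ), (∀ j, ‖w j‖ ≤ ‖cc k‖) → ‖∑ j, (p j : ℂ) * w j‖ ≤ (∑ j, |(p j : ℝ)|) * ‖cc k‖ := by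
    intro w hw
    refine (norm_sum_le _ _).trans ?_
    rw [Finset.sum_mul]
    refine Finset.sum_le_sum fun j _ => ?_
    rw [norm_mul, Complex.norm_intCast]
    exact mul_le_mul_of_nonneg_left (hw j) (abs_nonneg _)
  have h1 : ‖∑ j, (p j : ℂ) * cc k j‖ ≤ (∑ j, |(p j : ℝ)|) * ‖cc k‖ :=
    hdot (fun j => cc k j) fun j => PiLp.norm_apply_le (cc k) j
  have h2 : ‖∑ j, (p j : ℂ) * (starRingEnd ℂ) (cc k j)‖ ≤ (∑ j, |(p j : ℝ)|) * ‖cc k‖ :=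
    hdot (fun j => (starRingEnd ℂ) (cc k j)) fun j => by
      rw [Complex.norm_conj]; exact PiLp.norm_apply_le (cc k) j
  have hA : 0 ≤ (∑ j, |(p j : ℝ)|) * ‖cc k‖ := mul_nonneg (Finset.sum_nonneg fun j _ => abs_nonneg _) (norm_nonneg _)
  calc ‖(∑ j, (p j : ℂ) * cc k j) * Y (p - k) + (∑ j, (p j : ℂ) * (starRingEnd ℂ) (cc k j)) * Y (p + k)‖
      ≤ ‖(∑ j, (p j : ℂ) * cc k j) * Y (p - k)‖ + ‖(∑ j, (p j : ℂ) * (starRingEnd ℂ) (cc k j)) * Y (p + k)‖ :=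
        norm_add_le _ _
    _ ≤ (∑ j, |(p j : ℝ)|) * ‖cc k‖ * ‖Y (p - k)‖ + (∑ j, |(p j : ℝ)|) * ‖cc k‖ * ‖Y (p + k)‖ := by
        rw [norm_mul, norm_mul]
        gcongr
    _ = (∑ j, |(p j : ℝ)|) * ‖cc k‖ * (‖Y (p - k)‖ + ‖Y (p + k)‖) := by ring

end TrigModes

section TrigWeak

variable {T ν : ℝ} {S : Finset (d → ℤ)} {c : ℝ → (d → ℤ) → EuclideanSpace ℂ d}
  {u : ℝ → UnitAddTorus d → EuclideanSpace ℝ d} {h θ₀ : UnitAddTorus d → ℝ} {θ : ℝ → UnitAddTorus d → ℝ}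

/-- The right-hand side of the modal equation of a weak solution stirred by `realTrigPoly S (c s)`:
`-4π²ν|p|² 𝓕θ(s)(p) - N_p(s) + 𝓕h(p)`. [folklore] -/
def modeRHS (ν : ℝ) (S : Finset (d → ℤ)) (c : ℝ → (d → ℤ) → EuclideanSpace ℂ d) (h : UnitAddTorus d → ℝ)
    (Y : ℝ → (d → ℤ) → ℂ) (p : d → ℤ) (s : ℝ) : ℂ :=
  -(((4 * Real.pi ^ 2 * ν * FunctionSpaces.Torus.freqNormSq p : ℝ)) : ℂ) * Y s p -
    transportMode S (c s) (Y s) p + mFourierCoeff (fun x => (h x : ℂ)) p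

/-- The modes `(s, p) ↦ 𝓕θ(s)(p)` of a scalar field (notation). [folklore] -/
def modes (θ : ℝ → UnitAddTorus d → ℝ) : ℝ → (d → ℤ) → ℂ :=
  fun s p => mFourierCoeff (fun x => (θ s x : ℂ)) p

/-- Unfolding `modes`. [folklore] -/
theorem modes_apply (θ : ℝ → UnitAddTorus d → ℝ) (s : ℝ) (p : d → ℤ) :
    modes θ s p = mFourierCoeff (fun x => (θ s x : ℂ)) p := rfl

/-- If the coefficient paths are continuous and bounded, `s ↦ N_p(s)` built on the modes of a
forced weak solution is integrable on `(0,T)`. [folklore] -/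
theorem trig_integrableOn_transportMode (hw : IsWeakScalarTransportForcedOn T ν u (fun _ => h) θ₀ θ)
    (hc : ∀ k, Continuous fun s => c s k) {M : ℝ} (hM : ∀ s k, ‖c s k‖ ≤ M) (p : d → ℤ) :
    Integrable (fun s => transportMode S (c s) (modes θ s) p) (volume.restrict (Ioo 0 T)) := by
  unfold transportMode
  refine Integrable.const_mul (integrable_finsetSum _ fun k _ => Integrable.add ?_ ?_) _
  · refine (forced_integrableOn_mFourierCoeff hw (p - k)).bdd_mul (c := (∑ j, |(p j : ℝ)|) * M) ?_ ?_
    · exact (continuous_finsetSum _ fun j _ => continuous_const.mul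
        ((EuclideanSpace.proj j).continuous.comp (hc k))).aestronglyMeasurable
    · refine Eventually.of_forall fun s => (norm_sum_le _ _).trans ?_
      rw [Finset.sum_mul]
      refine Finset.sum_le_sum fun j _ => ?_
      rw [norm_mul, Complex.norm_intCast]
      exact mul_le_mul_of_nonneg_left ((PiLp.norm_apply_le (c s k) j).trans (hM s k)) (abs_nonneg _)
  · refine (forced_integrableOn_mFourierCoeff hw (p + k)).bdd_mul (c := (∑ j, |(p j : ℝ)|) * M) ?_ ?_
    · exact (continuous_finsetSum _ fun j _ => continuous_const.mul
        (Complex.continuous_conj.comp ((EuclideanSpace.proj j).continuous.comp (hc k)))).aestronglyMeasurable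
    · refine Eventually.of_forall fun s => (norm_sum_le _ _).trans ?_
      rw [Finset.sum_mul]
      refine Finset.sum_le_sum fun j _ => ?_
      rw [norm_mul, Complex.norm_intCast, Complex.norm_conj]
      exact mul_le_mul_of_nonneg_left ((PiLp.norm_apply_le (c s k) j).trans (hM s k)) (abs_nonneg _)

/-- The modal right-hand side is integrable on `(0,T)`. [folklore] -/
theorem trig_integrableOn_modeRHS (hw : IsWeakScalarTransportForcedOn T ν u (fun _ => h) θ₀ θ)
    (hc : ∀ k, Continuous fun s => c s k) {M : ℝ} (hM : ∀ s k, ‖c s k‖ ≤ M) (p : d → ℤ) :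
    Integrable (modeRHS ν S c h (modes θ) p) (volume.restrict (Ioo 0 T)) := by
  haveI : IsFiniteMeasure ((volume : Measure ℝ).restrict (Ioo 0 T)) := ⟨by
    rw [Measure.restrict_apply_univ]; exact measure_Ioo_lt_top⟩
  have h1 : Integrable (fun s => -(((4 * Real.pi ^ 2 * ν * FunctionSpaces.Torus.freqNormSq p : ℝ)) : ℂ) * modes θ s p)
      (volume.restrict (Ioo 0 T)) := (forced_integrableOn_mFourierCoeff hw p).const_mul _
  exact (h1.sub (trig_integrableOn_transportMode hw hc hM p)).add (integrable_const _)

/-- **The modal integral equation under trigonometric-polynomial stirring**: for every weak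
solution of the crux's forced class stirred by `u(t) = realTrigPoly S (c t)` (steady integrable
source, integrable datum), for a.e. `t ∈ (0,T)`,
`𝓕θ(t)(p) = 𝓕θ₀(p) + ∫_{(0,t]} (-4π²ν|p|² 𝓕θ(s)(p) - N_p(s) + 𝓕h(p)) ds`. [folklore] -/
theorem trig_ae_mode_eq (hw : IsWeakScalarTransportForcedOn T ν u (fun _ => h) θ₀ θ)
    (hu : ∀ s, u s = realTrigPoly S (c s)) (hh : Integrable h volume) (hθ₀ : Integrable θ₀ volume) (p : d → ℤ) :
    ∀ᵐ t ∂(volume.restrict (Ioo 0 T)),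
      modes θ t p = mFourierCoeff (fun x => (θ₀ x : ℂ)) p + ∫ s in Ioc 0 t, modeRHS ν S c h (modes θ) p s := by
  have hslice : ∀ᵐ s ∂(volume.restrict (Ioo 0 T)),
      (-(((4 * Real.pi ^ 2 * ν * FunctionSpaces.Torus.freqNormSq p : ℝ)) : ℂ) * mFourierCoeff (fun x => (θ s x : ℂ)) p -
        ∑ j, (2 * Real.pi * I * (p j)) * mFourierCoeff (fun x => ((θ s x * u s x j : ℝ) : ℂ)) p +
          mFourierCoeff (fun x => (h x : ℂ)) p) = modeRHS ν S c h (modes θ) p s := by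
    filter_upwards [forced_ae_integrable_slice hw] with s hs
    rw [modeRHS, modes, hu s, sum_mFourierCoeff_flux_eq_transportMode hs.1 S (c s) p]
    rfl
  filter_upwards [forced_ae_mFourierCoeff_eq hw hh hθ₀ p, ae_restrict_mem measurableSet_Ioo] with t ht htT
  rw [modes, ht]
  congr 1
  refine setIntegral_congr_ae measurableSet_Ioc ?_
  have hsub : ∀ᵐ s ∂(volume : Measure ℝ), s ∈ Ioo 0 T → _ := (ae_restrict_iff' measurableSet_Ioo).1 hslice
  filter_upwards [hsub] with s hs hsI
  exact hs (Ioc_subset_Ioo_right htT.2 hsI)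

end TrigWeak

end Summit.AnomalousDissipation.AnomalousDissipation.Theorems.ScalarAnomalySteadySourceFormal.Negative
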